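import Literature.Analysis.FluidPDE.SelfSimilarCollapseAnsatz
import Literature.Analysis.FluidPDE.NSWave0
import HarnessLib

/-!
# The Euler-window ansatz as a FORCED Navier–Stokes flow: its a-posteriori force is never Clay,
# and the E–C order ladder

Cell `ns-blowup`, seat `ns-blowup-ecbridge-2` (g3; E–C endpoint theory seat). LABEL: E–C typing
(KERNEL §1–§3) + exponent BOOKKEEPING of a formal expansion (§4, arithmetic only). WHAT THIS IS NOT:
not Navier–Stokes evidence — no profile is claimed to exist (the regularity cell's crux
`…Theses.VortexLineClock.EmptyEulerWindow`, item stmt-NavierStokesRegularity-11273, says none does in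
the window `2/5 ≤ γ < 1/2`); the statements say what the a-posteriori force of the ansatz built on a
HYPOTHETICAL profile would be. Companion memo `run/shared/lean/pub/ns-blowup/ecbridge2/ECBRIDGE-2-MEMO-2.md`
§3; generic closer `DesignedBlowupClayBridge.lean` (same seat).

## Content

The tree's `SelfSimilarCollapseAnsatz.lean` (regularity side, CIV 2026 (3.2)–(3.3)) proves that for an
exact self-similar Euler profile `IsSelfSimilarEulerProfile γ 0 U P` the ansatz
`u = (T−t)^{γ−1}U((T−t)^{−γ}x)`, `p = (T−t)^{2γ−2}P(…)` has Navier–Stokes defect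
`∂ₜu + (u·∇)u + ∇p − νΔu = −ν(T−t)^{−1−γ}ΔU(y)` (`IsSelfSimilarEulerProfile.ns_defect_selfSimilarCollapse`).
Read from the E–C endpoint (Fefferman's (C): breakdown WITH a smooth decaying force) this says:

* §1 `eulerWindowForce ν γ T U` — the a-posteriori force `f(t,x) := −ν(T−t)^{−1−γ}ΔU((T−t)^{−γ}x)`,
  and `IsSelfSimilarEulerProfile.forced_momentum_selfSimilarCollapse`: `(u, p)` satisfies the
  FORCED momentum equation `∂ₜu + (u·∇)u = νΔu − ∇p + f` pointwise for `t < T` — the raw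
  Euler-window ansatz IS a style-(β) designed blow-up of the forced system (order `0` of the memo's
  ladder), for every viscosity `ν`.
* §2 `norm_eulerWindowForce` and `eulerWindowForce_unbounded`: `‖f(t,x)‖ = |ν|(T−t)^{−1−γ}‖ΔU(y)‖`,
  so if `ν ≠ 0`, `γ > −1` and `ΔU(y₀) ≠ 0` at one point, `f` is UNBOUNDED along
  `x_t = (T−t)^{γ}y₀` as `t ↑ T` (all exponents: the window is irrelevant here).
* §3 `clayForce_bounded` (a Clay-class force — `IsSmoothOnHalfSpace ∧ HasRapidSpaceTimeDecay` — is
  bounded on `[0,∞) × ℝ³`, the `n = K = 0` instance of (5)) and the ORDER-ZERO OBSTRUCTION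
  `eulerWindowForce_ne_clayForce`: no Clay-class force agrees with `f` on `[0, T) × ℝ³`. So an exact
  Euler profile ALONE is never an E–C claim: the viscous corrections are compulsory.
* §4 the E–C ORDER LADDER (bookkeeping; HEUR status stated in each docstring): a formal viscous
  correction of order `j` is `O(ν_eff^j) = O((T−t)^{j(1−2γ)})` relative to the profile
  (`effectiveViscosity`), so the order-`J` residual carries the power
  `residualExponent γ J = −1−γ + J(1−2γ)` of `T−t`. For `γ < 1/2` this is `≥ m` iff
  `J ≥ (m+1+γ)/(1−2γ)` (`le_residualExponent_iff`): a force bounded together with its first `m`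
  time-derivatives needs `⌈(m+1+γ)/(1−2γ)⌉` exact corrections, a `C^∞` (Clay) force needs ALL orders,
  and at Leray's `γ = 1/2` the exponent is `−3/2` for every `J` (`residualExponent_half`) — no finite
  or infinite order makes the designed force bounded: at the Kelvin-natural exponent the E–C endpoint
  is closed unless the profile is an exact Navier–Stokes profile (excluded: NRŠ/Tsai, tree
  `necas_ruzicka_sverak_holds` / `tsai_selfsimilar_holds`; asymptotic form Chae 2007 Thm 1.5, tree fact
  `chae2007_asymptoticallySelfSimilar_local`). Worked instances: `γ = 2/5 ⇒ J ≥ 7`,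
  `γ = 9/20 ⇒ J ≥ 29/2`.

References: P. Constantin, M. Ignatova, V. Vicol, arXiv:2602.17570 (2026) §3 (3.2)–(3.3)
[cite: ConstantinIgnatovaVicol2026Putative, §3.1]; C. L. Fefferman, Clay problem description, (C), (5)
[cite: FeffermanClay2006, (C) (5)]; D. Chae, Math. Ann. 338 (2007), Thm 1.5 [cite: Chae2007, Thm 1.5];
T. Y. Hou, arXiv:2405.10916 §3 (effective viscosity `ν(T−t)^{1−2c_l}`) [cite: Hou2026, §3].
-/

noncomputable section

namespace Summit.NavierStokesRegularity.FluidComputer.EulerWindow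

open Set Filter Topology Function InnerProductSpace
open scoped Laplacian RealInnerProductSpace
open Literature.Analysis.FluidPDE

/-! ## §1 The a-posteriori force of the Euler-window ansatz -/

/-- **The a-posteriori force of the Euler-window ansatz**: for a profile `U` and viscosity `ν`,
`f(t, x) = −ν (T−t)^{−1−γ} • ΔU((T−t)^{−γ} x)` — the Navier–Stokes defect of the self-similar Euler
ansatz `selfSimilarCollapse γ T U` moved to the right-hand side (meaningful for `t < T`).
[cite: ConstantinIgnatovaVicol2026Putative, §3.1 eq. (3.2)] -/
def eulerWindowForce (ν γ T : ℝ) (U : EuclideanSpace ℝ (Fin 3) → EuclideanSpace ℝ (Fin 3)) :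
    ℝ → EuclideanSpace ℝ (Fin 3) → EuclideanSpace ℝ (Fin 3) :=
  fun t x => -((ν * (T - t) ^ (-1 - γ)) • (Δ U) ((T - t) ^ (-γ) • x))

/-- Unfolding `eulerWindowForce`. [cite: ConstantinIgnatovaVicol2026Putative, §3.1 eq. (3.2)] -/
@[simp] theorem eulerWindowForce_apply (ν γ T : ℝ)
    (U : EuclideanSpace ℝ (Fin 3) → EuclideanSpace ℝ (Fin 3)) (t : ℝ) (x : EuclideanSpace ℝ (Fin 3)) :
    eulerWindowForce ν γ T U t x = -((ν * (T - t) ^ (-1 - γ)) • (Δ U) ((T - t) ^ (-γ) • x)) := rfl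

variable {γ T t ν : ℝ} {U : EuclideanSpace ℝ (Fin 3) → EuclideanSpace ℝ (Fin 3)}
  {P : EuclideanSpace ℝ (Fin 3) → ℝ}

/-- Exponent bookkeeping below the blow-up time. [folklore] -/
private theorem rpow_sub_mul (ht : t < T) (a b : ℝ) :
    (T - t) ^ a * (T - t) ^ b = (T - t) ^ (a + b) :=
  (Real.rpow_add (sub_pos.mpr ht) a b).symm

/-- **The Euler-window ansatz solves the FORCED Navier–Stokes momentum equation with force
`eulerWindowForce`** (order `0` of the E–C ladder): for an exact self-similar Euler profile
`IsSelfSimilarEulerProfile γ 0 U P`, every viscosity `ν` and every `t < T`,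
`∂ₜu + (u·∇)u = νΔu − ∇p + f` pointwise, with `u = selfSimilarCollapse γ T U`,
`p = selfSimilarCollapsePressure γ T P`, `f = eulerWindowForce ν γ T U` (rearrangement of the tree's
`IsSelfSimilarEulerProfile.ns_defect_selfSimilarCollapse`).
[cite: ConstantinIgnatovaVicol2026Putative, §3.1 eqs. (3.2)–(3.3)] -/
theorem forced_momentum_selfSimilarCollapse (h : IsSelfSimilarEulerProfile γ 0 U P) (ht : t < T)
    (ν : ℝ) (x : EuclideanSpace ℝ (Fin 3)) :
    timeDeriv (selfSimilarCollapse γ T U) t x +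
        convect (selfSimilarCollapse γ T U t) (selfSimilarCollapse γ T U t) x =
      ν • (Δ (selfSimilarCollapse γ T U t)) x - gradient (selfSimilarCollapsePressure γ T P t) x +
        eulerWindowForce ν γ T U t x := by
  have hd := h.ns_defect_selfSimilarCollapse (T := T) ht ν x
  have hcoef : (T - t) ^ (γ - 2) • effectiveViscosity ν γ T t • (Δ U) ((T - t) ^ (-γ) • x) =
      (ν * (T - t) ^ (-1 - γ)) • (Δ U) ((T - t) ^ (-γ) • x) := by
    rw [smul_smul, rpow_mul_effectiveViscosity ht ν]
  rw [hcoef] at hd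
  rw [eulerWindowForce_apply]
  -- `A + B + C - D = -F` ⇒ `A + B = D - C + (-F)`
  have := hd
  abel_nf at this ⊢
  rw [← sub_eq_zero] at this ⊢
  abel_nf at this ⊢
  simpa using this

/-! ## §2 The force is unbounded at the singular point -/

/-- **Size of the a-posteriori force**: `‖f(t, x)‖ = |ν| (T−t)^{−1−γ} ‖ΔU((T−t)^{−γ}x)‖` for `t < T`.
[cite: ConstantinIgnatovaVicol2026Putative, §3.1 eq. (3.2)] -/
theorem norm_eulerWindowForce (ht : t < T) (x : EuclideanSpace ℝ (Fin 3)) :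
    ‖eulerWindowForce ν γ T U t x‖ = |ν| * (T - t) ^ (-1 - γ) * ‖(Δ U) ((T - t) ^ (-γ) • x)‖ := by
  rw [eulerWindowForce_apply, norm_neg, norm_smul, Real.norm_eq_abs, abs_mul,
    abs_of_pos (Real.rpow_pos_of_pos (sub_pos.mpr ht) _)]

/-- **The a-posteriori force of the raw Euler-window ansatz is unbounded near the singular point**:
if `ν ≠ 0`, `γ > −1` (so the exponent `−1−γ` is negative — every exponent of the window
`2/5 ≤ γ < 1/2`, indeed every positive one, qualifies) and `ΔU(y₀) ≠ 0` at some point, then along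
`x_t = (T−t)^γ y₀` the force exceeds every bound as `t ↑ T`. [cite: ConstantinIgnatovaVicol2026Putative, §3.1 eq. (3.2)] -/
theorem eulerWindowForce_unbounded (hν : ν ≠ 0) (hγ : -1 < γ) {y₀ : EuclideanSpace ℝ (Fin 3)}
    (hy₀ : (Δ U) y₀ ≠ 0) (M : ℝ) :
    ∀ᶠ t in 𝓝[<] T, M < ‖eulerWindowForce ν γ T U t ((T - t) ^ γ • y₀)‖ := by
  -- `(T−t)^{−1−γ} → +∞` as `t ↑ T`
  have h0 : Tendsto (fun t : ℝ => T - t) (𝓝[<] T) (𝓝[>] 0) := by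
    refine tendsto_nhdsWithin_of_tendsto_nhds_of_eventually_within _ ?_ ?_
    · have : Tendsto (fun t : ℝ => T - t) (𝓝 T) (𝓝 (T - T)) :=
        (continuous_const.sub continuous_id).tendsto T
      rw [sub_self] at this
      exact this.mono_left nhdsWithin_le_nhds
    · filter_upwards [self_mem_nhdsWithin] with t ht
      exact sub_pos.mpr (Set.mem_Iio.mp ht)
  have h2 : Tendsto (fun t : ℝ => (T - t) ^ (-1 - γ)) (𝓝[<] T) atTop :=
    (tendsto_rpow_neg_nhdsGT_zero (by linarith)).comp h0
  have hc : 0 < |ν| * ‖(Δ U) y₀‖ := mul_pos (abs_pos.mpr hν) (norm_pos_iff.mpr hy₀)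
  have h3 : Tendsto (fun t : ℝ => (T - t) ^ (-1 - γ) * (|ν| * ‖(Δ U) y₀‖)) (𝓝[<] T) atTop :=
    h2.atTop_mul_const hc
  filter_upwards [h3.eventually_gt_atTop M, self_mem_nhdsWithin] with t ht htT'
  have htT : t < T := Set.mem_Iio.mp htT'
  have hy : (T - t) ^ (-γ) • ((T - t) ^ γ • y₀) = y₀ := by
    rw [smul_smul, rpow_sub_mul htT, neg_add_cancel, Real.rpow_zero, one_smul]
  rw [norm_eulerWindowForce htT, hy]
  exact lt_of_lt_of_eq ht (by ring)

/-- The same unboundedness read on the Clay half-space `t ≥ 0` (for `T > 0`): for every bound `M`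
there are `t ∈ [0, T)` and `x` with `M < ‖f(t, x)‖`. [cite: ConstantinIgnatovaVicol2026Putative, §3.1 eq. (3.2)] -/
theorem exists_lt_norm_eulerWindowForce (hT : 0 < T) (hν : ν ≠ 0) (hγ : -1 < γ)
    {y₀ : EuclideanSpace ℝ (Fin 3)} (hy₀ : (Δ U) y₀ ≠ 0) (M : ℝ) :
    ∃ t ∈ Ico 0 T, ∃ x, M < ‖eulerWindowForce ν γ T U t x‖ := by
  have hev := eulerWindowForce_unbounded (T := T) hν hγ hy₀ M
  have hIco : Ico 0 T ∈ 𝓝[<] T := Ico_mem_nhdsLT hT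
  obtain ⟨t, ht, htI⟩ := (hev.and hIco).exists
  exact ⟨t, htI, _, ht⟩

/-! ## §3 A Clay force is bounded: the order-zero obstruction -/

/-- **A Clay-class force is bounded on the closed half-space** (the `n = 0`, `K = 0` instance of
Fefferman's decay (5): `‖f(t, x)‖ = ‖D⁰f(t, x)‖ ≤ C`). [cite: FeffermanClay2006, (5)] -/
theorem clayForce_bounded {g : ℝ → EuclideanSpace ℝ (Fin 3) → EuclideanSpace ℝ (Fin 3)}
    (hdec : HasRapidSpaceTimeDecay g) : ∃ C : ℝ, ∀ t, 0 ≤ t → ∀ x, ‖g t x‖ ≤ C := by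
  obtain ⟨C, hC⟩ := hdec 0 0
  refine ⟨C, fun t ht x => ?_⟩
  have h := hC t ht x
  rw [pow_zero, one_mul, norm_iteratedFDerivWithin_zero] at h
  simpa using h

/-- **ORDER-ZERO OBSTRUCTION.** For `T > 0`, `ν ≠ 0`, `γ > −1` and a profile with `ΔU(y₀) ≠ 0`
somewhere, NO Clay-class force (`HasRapidSpaceTimeDecay`, a fortiori any force smooth on the closed
half-space with Fefferman's decay (5)) agrees with the a-posteriori force of the Euler-window ansatz
on `[0, T) × ℝ³`: the exact self-similar Euler profile ALONE is never an E–C claim — its designed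
force is unbounded at the singular point, every Clay force is bounded. (The harmonic case `ΔU ≡ 0`
is excluded for every profile with the CIV far-field decay by Liouville; not needed here.)
[cite: FeffermanClay2006, (C) (5)] [cite: ConstantinIgnatovaVicol2026Putative, §3.1 eq. (3.2)] -/
theorem eulerWindowForce_ne_clayForce (hT : 0 < T) (hν : ν ≠ 0) (hγ : -1 < γ)
    {y₀ : EuclideanSpace ℝ (Fin 3)} (hy₀ : (Δ U) y₀ ≠ 0)
    {g : ℝ → EuclideanSpace ℝ (Fin 3) → EuclideanSpace ℝ (Fin 3)} (hdec : HasRapidSpaceTimeDecay g) :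
    ¬ ∀ t ∈ Ico 0 T, ∀ x, g t x = eulerWindowForce ν γ T U t x := by
  intro hagree
  obtain ⟨C, hC⟩ := clayForce_bounded hdec
  obtain ⟨t, ht, x, hlt⟩ := exists_lt_norm_eulerWindowForce (U := U) hT hν hγ hy₀ C
  rw [← hagree t ht x] at hlt
  exact absurd (hC t ht.1 x) (not_le.mpr hlt)

/-! ## §4 The E–C order ladder (bookkeeping of the formal viscous expansion)

HONEST STATUS: the quantity `residualExponent γ J` below records the power of `T − t` carried by the
residual of a FORMAL expansion `U₀ + ν_eff U₁ + ν_eff² U₂ + …` truncated at order `J`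
(`ν_eff = ν(T−t)^{1−2γ}`, tree `effectiveViscosity`; order `0` is §1–§2, where the power `−1−γ` is a
theorem). That the order-`J` truncation exists (solvability of the linearised profile operator shifted
by `j(1−2γ)` in the class with CIV decay, `j ≤ J`) and that its residual is EXACTLY of this order are
NOT asserted here — they are the memo's (β′) programme. The lemmas are pure real arithmetic. -/

/-- **Residual exponent of the order-`J` truncation**: `−1−γ + J(1−2γ)` (power of `T−t` in the
a-posteriori force after `J` viscous corrections; `J = 0`: §2). [cite: Hou2026, §3] -/
def residualExponent (γ : ℝ) (J : ℝ) : ℝ := -1 - γ + J * (1 - 2 * γ)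

/-- Unfolding `residualExponent`. [cite: Hou2026, §3] -/
@[simp] theorem residualExponent_apply (γ J : ℝ) :
    residualExponent γ J = -1 - γ + J * (1 - 2 * γ) := rfl

/-- Order zero is the exponent of §2: `residualExponent γ 0 = −1−γ`. [cite: Hou2026, §3] -/
theorem residualExponent_zero (γ : ℝ) : residualExponent γ 0 = -1 - γ := by simp

/-- **Inside the window the ladder climbs**: for `γ < 1/2` and a target power `m` (a force bounded
together with its first `m` time derivatives needs residual power `≥ m`, each `∂ₜ` costing one power
of `T−t`), `m ≤ residualExponent γ J ↔ (m + 1 + γ)/(1 − 2γ) ≤ J`. [cite: Hou2026, §3] -/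
theorem le_residualExponent_iff {γ : ℝ} (hγ : γ < 1 / 2) (m J : ℝ) :
    m ≤ residualExponent γ J ↔ (m + 1 + γ) / (1 - 2 * γ) ≤ J := by
  have hpos : 0 < 1 - 2 * γ := by linarith
  rw [residualExponent_apply, div_le_iff₀ hpos]
  constructor <;> intro h <;> linarith

/-- **At Leray's exponent the ladder is flat**: `residualExponent (1/2) J = −3/2` for every `J` — no
finite or infinite number of corrections makes the designed force bounded (the E–C endpoint is closed
at `γ = 1/2` unless the profile is an exact Navier–Stokes profile). [cite: Chae2007, Thm 1.5] -/
theorem residualExponent_half (J : ℝ) : residualExponent (1 / 2) J = -(3 / 2) := by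
  rw [residualExponent_apply]; ring

/-- **Above the window the ladder descends**: for `γ > 1/2` the residual exponent is strictly
decreasing in `J` (viscosity is dominant; corrections make the designed force more singular).
[cite: Hou2026, §3] -/
theorem residualExponent_strictAnti {γ : ℝ} (hγ : 1 / 2 < γ) : StrictAnti (residualExponent γ) := by
  intro J J' hJ
  simp only [residualExponent_apply]
  nlinarith

/-- **Minimal order for a bounded designed force** (`m = 0`): inside the window,
`0 ≤ residualExponent γ J ↔ (1 + γ)/(1 − 2γ) ≤ J`; in particular `J ≥ 7` at the energy edge
`γ = 2/5` and `J ≥ 29/2` at `γ = 9/20`, and the threshold tends to `+∞` as `γ ↑ 1/2`.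
[cite: Hou2026, §3] -/
theorem nonneg_residualExponent_iff {γ : ℝ} (hγ : γ < 1 / 2) (J : ℝ) :
    0 ≤ residualExponent γ J ↔ (1 + γ) / (1 - 2 * γ) ≤ J := by
  have h := le_residualExponent_iff hγ 0 J
  rwa [zero_add] at h

/-- Worked instance at the energy edge `γ = 2/5`: the threshold is `7`. [cite: ConstantinIgnatovaVicol2026Putative, Thm 2.1 (γ ≥ 2/5)] -/
theorem threshold_two_fifths : (1 + (2 / 5 : ℝ)) / (1 - 2 * (2 / 5)) = 7 := by norm_num

/-- Worked instance at `γ = 9/20`: the threshold is `29/2` (so `15` corrections). [cite: Hou2026, §3] -/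
theorem threshold_nine_twentieths : (1 + (9 / 20 : ℝ)) / (1 - 2 * (9 / 20)) = 29 / 2 := by norm_num

/-- **The threshold diverges at the Leray edge**: `(1 + γ)/(1 − 2γ) → +∞` as `γ ↑ 1/2`.
[cite: Chae2007, Thm 1.5] -/
theorem tendsto_threshold_atTop :
    Tendsto (fun γ : ℝ => (1 + γ) / (1 - 2 * γ)) (𝓝[<] (1 / 2)) atTop := by
  -- numerator → 3/2 > 0, denominator → 0⁺
  have hnum : Tendsto (fun γ : ℝ => 1 + γ) (𝓝[<] (1 / 2)) (𝓝 (3 / 2)) := by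
    have : Tendsto (fun γ : ℝ => 1 + γ) (𝓝 (1 / 2 : ℝ)) (𝓝 (1 + 1 / 2)) :=
      (continuous_const.add continuous_id).tendsto _
    rw [show (1 : ℝ) + 1 / 2 = 3 / 2 by norm_num] at this
    exact this.mono_left nhdsWithin_le_nhds
  have hden : Tendsto (fun γ : ℝ => 1 - 2 * γ) (𝓝[<] (1 / 2)) (𝓝[>] 0) := by
    refine tendsto_nhdsWithin_of_tendsto_nhds_of_eventually_within _ ?_ ?_
    · have : Tendsto (fun γ : ℝ => 1 - 2 * γ) (𝓝 (1 / 2 : ℝ)) (𝓝 (1 - 2 * (1 / 2))) :=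
        (continuous_const.sub (continuous_const.mul continuous_id)).tendsto _
      rw [show (1 : ℝ) - 2 * (1 / 2) = 0 by norm_num] at this
      exact this.mono_left nhdsWithin_le_nhds
    · filter_upwards [self_mem_nhdsWithin] with γ hγ
      have hγ' : γ < 1 / 2 := Set.mem_Iio.mp hγ
      show 0 < 1 - 2 * γ
      linarith
  have h := hnum.pos_mul_atTop (by norm_num) (tendsto_inv_nhdsGT_zero.comp hden)
  exact h.congr (fun γ => (div_eq_mul_inv _ _).symm)

end Summit.NavierStokesRegularity.FluidComputer.EulerWindow

end
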